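import Mathlib
import HarnessLib
import HarnessLib.Audit
import Summits.CriticalPhenomena.Statement
import Summits.CriticalPhenomena.Ising3DConformalLimit.Theorems.HyperoctahedralRPCriticalCorrNineMirrorRP
import HarnessLib.Audit.Status.Attr

/-!
Route: MirrorHoelderCompactness

DORMANT since 2026-08-26T07:17:40Z (reconciler: no traction for 8.4 d (last activity item-evidence-added at 2026-08-17T21:30:30Z); parked, not closed — `ledger route dormant route-CriticalPhenomena-MirrorHoelderCompactness --off` to rea) — unstaffed, not closed; items shared with open routes are served there. `ledger route dormant <id> --off` reactivates.

# Route MirrorHoelderCompactness — existence by compactness — nine-mirror RP Hoelder modulus +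
two-point doubling reduce the 3D Ising scaling limit to pointwise convergence

It suffices to show X_MH = (D) ∧ (SH) ∧ (NS) ∧ (PL) ∧ (LAC), realising card mirror-hoelder-modulus
as the COMPACTNESS HALF of the
existence clause of Ising3DConformalLimit. Write g(n) = ⟨σ₀σ_{ne₁}⟩⁺_{β_c(3)}, ρ★(δ) :=
g(⌊1/δ⌋)^{-1/2} (the forced renormalisation, typed
exactly as in route ClusterRigidity) and F_n^δ := rescaledCorrelator (criticalCorr 3) ρ★ n δ. (D)
all-scale doubling g(2n) ≥ κ g(n). (SH) [the
card's theorem, given D] F_n^δ is asymptotically Hölder-1/2, uniformly in δ on compacts, in every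
variable x_i that one of the NINE lattice mirror
directions (normals e_i, e_i ± e_j — all reflection symmetries of n.n. ℤ³) separates with a margin
from the other points, via two lattice
lemmas: the nine-direction gradient estimate (L1) and the RP–Cauchy–Schwarz transfer (L2). (NS)
asymptotic equicontinuity in the remaining,
non-separable ('caged') variables. (PL) pointwise convergence of F_n^δ(x) as δ → 0⁺ at each
non-coincident x. (LAC) imported complement: every
normalised non-degenerate translation-invariant scale-covariant pointwise limit of criticalCorr 3 is
O(3)-invariant, inversion covariant and
non-Gaussian (= route HyperoctahedralRP minus existence). Two engine-free glue items close the
chain: CompactnessGlue (D ∧ SH ∧ NS ⟹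
UniformRegularity — verbatim crux r3, item 4658, of route ClusterRigidity, which files it WITHOUT a
mechanism) and LimitConstruction
(UniformRegularity ∧ PL ⟹ ExistsScaleCovariantLimit — verbatim item 1981, the existence crux of
route HyperoctahedralRP and four other routes),
with translation invariance and scale covariance of the limit for free and Δ ≥ 1/2 from the proved
scalingDimension_mem_Icc_holds. So this
route DECOMPOSES two shared open cruxes (4658 ⇐ D + SH + NS; 1981 ⇐ 4658 + PL) and supplies the
precompactness that ClusterRigidity,
scaling-flow-omega-limit and zoom-flow-lyapunov-existence assume.
Lean: `TwoPointDoubling ∧ SeparableHoelder ∧ NonSeparableModulus ∧ PointwiseLimit ∧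
LimitsAreConformal`

## Assembly
Pure logic (theorem assembly_holds in the planner's Sketch.lean, rc 0, no sorry): CompactnessGlue
applied to D, SH, NS gives
UniformRegularity; LimitConstruction applied to it and PL yields
ρ, Δ, S with ρ > 0, Δ > 0, HasPointwiseScalingLimit, normalisation, IsNondegenerateTwoPoint,
IsTranslationInvariant, IsScaleCovariant Δ;
LimitsAreConformal applied to these gives IsRotationInvariant, IsInversionCovariant Δ,
HasNontrivialU4; then IsEuclideanInvariant :=
⟨transl, rot⟩, IsMoebiusCovariant Δ S := ⟨Euclid, scale, inversion⟩ and the conjunct's existential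
is ⟨ρ, Δ, S, …⟩. Support items not in the
chain (CriticalCorrNineMirrorRP, MirrorCauchySchwarz, NineMirrorGradient, RescaledBounds) are the
lemmas the proofs of SH and CompactnessGlue
consume; UniformRegularity (= conclusion of CompactnessGlue, shared with ClusterRigidity) and
ExistsScaleCovariantLimit (= conclusion of
LimitConstruction, shared with HyperoctahedralRP and four more routes) are the shared milestones.

Rationale: WHY THIS LINE. The open routes of this conjunct file EXISTENCE of the pointwise scaling limit as one
monolithic crux (items 1981, 0638, 1344) or, since today,
as precompactness + rigidity with the precompactness itself an engine-less crux (route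
ClusterRigidity, item 4658 UniformRegularity: "Hölder
continuity needs a mixing input"); this line supplies that precompactness from reflection positivity
alone, given two-point doubling, and
localises what is left. Mechanism (AizenmanDuminilCopinAnnals2021 §5.3–5.5 and DuminilCopinPanis2024
p.5 give the axis case of L1; FrohlichIsraelLiebSimon1978 /
Biskup2009 the OS form): RP in the planes normal to each of the nine B₃ directions makes t ↦
symmetrised G along that direction a Stieltjes
moment sequence, whence a gradient estimate |∇G| ≲ G/|z| in ALL lattice directions (the six diagonal
mirrors supply the transverse steps —
no rotation input); Cauchy–Schwarz for the OS form B(F,G) = ⟨θF·G⟩ with F = σ_x − σ_{x′} converts it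
into a Hölder-1/2 modulus of every
n-point function in each mirror-separable variable, with the 2(n−1)-point function of the doubled
configuration as the only size factor
(Gaussian pairing bound, Newman1975Gaussian/Aizenman1982). Imported area: Osterwalder–Schrader
positivity as a REGULARITY tool (constructive
QFT, GlimmJaffe1987 ch. 10–12, 19) plus Arzelà–Ascoli; no RG, no conformal maps, no exponent. What
it does that prior routes do not: turns the
one open two-point input (doubling) into n-point compactness, splits 1981 into compactness +
pointwise convergence (the interface the dynamics
cards need), and names the residual regularity problem precisely (caged points, crux NS). Negatives
index: only SAW 0772 — untouched.

RANKED CRUXES. #2 TwoPointDoubling (crux) — (D) ALL-SCALE DOUBLING of the axial critical two-point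
function on ℤ³: there is κ > 0 with g(2n) ≥ κ·g(n) for all n ≥ 1, g(n) := ⟨σ₀σ_{n e₁}⟩⁺_{β_c(3)}
(card item M3; = D1 of card every-scale-regular-multiplicative-fekete). With MMS it gives G(z′) ≍
G(z) for ‖z′‖ ≍ ‖z‖ in all directions; it is the one open LATTICE input of the compactness half and
is filed first (the import cone of everything below is otherwise proved:
criticalTwoPoint_bounds_holds, messager_miracleSole_holds, RP lemmas). [difficulty: open-problem]
(why it might fail: Two-point axiomatics (nine-plane RP, MMS, IR window, DC–Panis) admit crossover
profiles c|x|^(-3/2)+C·e^(-|x|/N)/|x| breaking doubling by N^(-1/4) (card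
crossover-witness-no-doubling; refuter note on 0667): needs an Ising-specific all-scale input; ADC21
Thm 5.12 gives abundant scales only.) [AizenmanDuminilCopinAnnals2021, DuminilCopinPanis2024,
arXiv:1912.07973, arXiv:2404.05700,
Literature.Probability.LatticeModels.criticalTwoPoint_bounds_holds]
#3 SeparableHoelder (crux) — (SH) THE CARD'S THEOREM (mirror-hoelder-modulus L1+L2 ⇒ Hölder-1/2
modulus), continuum form, conditional on (D): with ρ★(δ) := ⟨σ₀σ_{⌊1/δ⌋e₁}⟩^{-1/2}, for every n,
every compact K of non-coincident configurations and every margin m > 0 there are C, δ₀, h₀ such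
that for δ < δ₀, x ∈ K, and a move of ONE point x_i ↦ y with ‖y − x_i‖ ≤ h₀, if some nine-mirror
normal u ∈ {e_i, e_i ± e_j} separates x_i from the other points with margin m (⟨u,x_i⟩ ≥ ⟨u,x_j⟩ + m
∀ j ≠ i, or ≤ … − m), then |F_n^δ(x with x_i ↦ y) − F_n^δ(x)| ≤ C (‖y − x_i‖ + δ)^{1/2}, F_n^δ :=
rescaledCorrelator (criticalCorr 3) ρ★ n δ. Proof route: MirrorCauchySchwarz across the lattice
mirror nearest to the separating plane bounds the squared difference by a four-term second
difference of the TWO-point function at the reflected scale ≈ 2·dist(x_i,Π)/δ times the 2(n−1)-point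
function of Y ∪ θY; NineMirrorGradient + (D) + MMS make the first factor ≤ C(‖y−x_i‖+δ)/m·ρ★^{-2},
the Gaussian pairing bound + (D) the second ≤ Cρ★^{-2(n−1)}, uniformly in δ. [deps:
TwoPointDoubling, MirrorCauchySchwarz, NineMirrorGradient, RescaledBounds] [difficulty: L] (why it
might fail: Uniform constants need G(z')≍G(z) for comparable ‖z‖ in ALL directions (doubling+MMS)
and an infinite-volume pairing bound; the diagonal Stieltjes structure (site planes k, k−1) and the
lattice→continuum mirror bookkeeping at margin m are unwritten; exponent 1/2 may degrade to some
α>0.) [FrohlichIsraelLiebSimon1978, AizenmanDuminilCopinAnnals2021, DuminilCopinPanis2024,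
MessagerMiracleSoleJSP1977, Newman1975Gaussian, GlimmJaffe1987,
Literature.Probability.LatticeModels.rp_cauchySchwarz_holds]
#4 NonSeparableModulus (crux) — (NS) = card item M4, the honestly open complement of (SH):
asymptotic equicontinuity under one-point moves at configurations where the moving point is NOT
nine-separable. Form: for every n, compact K ⊆ NonCoincident and ε > 0 there are m, η, δ₀ > 0 such
that for δ < δ₀, x ∈ K, ‖y − x_i‖ < η and (x, i) not m-separable by any of the nine normals,
|F_n^δ(x with x_i ↦ y) − F_n^δ(x)| < ε (the ∃m lets the prover shrink the non-separable zone; SH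
covers the rest for that m). Partial mechanism for provers: iterating MirrorCauchySchwarz ('doubling
the configuration across a mirror') halves the Hölder exponent per step and turns a collinear
configuration into a planar trapezoid whose inner vertex one of the 18 rays exposes; by translation
invariance it also suffices that all OTHER points be separable. This resolves collinear and many
planar configurations but NOT a point caged by neighbours in all 26 directions of {−1,0,1}³ (the
cage is invariant under every doubling): there a different input (random-current regularity à la
ADC21 §6, or DLR-inherited regularity) is required. [deps: SeparableHoelder] [difficulty:
open-problem] (why it might fail: No lattice mechanism at caged points: iterated mirror doubling
resolves collinear configurations, but the 3×3×3 direction cage around a point is a fixed point of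
all nine doublings (planner's paper check); needs a mixing/regularity input à la ADC21 §6 or a new
idea; maybe as hard as continuity of S.) [AizenmanDuminilCopinAnnals2021, arXiv:1912.07973,
GlimmJaffe1987, ChelkakHonglerIzyurov2015]
#5 PointwiseLimit (crux) — (PL) POINTWISE CONVERGENCE with the forced renormalisation: for every n
and every non-coincident x, ρ₀(δ)^n ⟨∏σ_{[x_k/δ]}⟩⁺_{β_c(3)} converges as δ → 0⁺ (to some real
number). This is the uniqueness-of-cluster-points half of existence, deliberately separated from
compactness: given (D)+(SH)+(NS) it is EQUIVALENT to locally uniform convergence (Arzelà–Ascoli),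
and it is exactly what the dynamics/rigidity cards (rigidity-supplies-uniqueness,
scaling-flow-omega-limit, zoom-flow-lyapunov-existence) propose to deliver from compactness +
identification/Lyapunov inputs; those become separate routes sharing this decl and the compactness
items. [difficulty: open-problem] (why it might fail: This is existence in its weakest (pointwise,
fixed ρ₀) form and is open: RP/GKS/MMS axiomatics admit log-periodic, discretely scale-invariant
profiles (card rp-cannot-fix-the-scale-log-periodic), an RG limit cycle would violate it, and no
identification of the 3D limit exists (ICM2022 §8.4).) [DuminilCopinICM2022,
AizenmanDuminilCopinAnnals2021, doi:10.1214/13-aop881, ChelkakHonglerIzyurov2015]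
#6 LimitsAreConformal (crux) — (LAC) IMPORTED COMPLEMENT (lowest rank): every pointwise scaling
limit S of criticalCorr 3 (ρ > 0 on (0,1]) that is normalised (S = 0 off NonCoincident — the typing
fix of Theorems/IsingEuclidUpgradeRefutations.lean), non-degenerate, translation invariant and scale
covariant with Δ is O(3)-invariant, inversion covariant with the same Δ, and has U₄ ≢ 0. This is
route HyperoctahedralRP minus its existence crux (it follows in three lines from that route's
HRP2Rigidity + LimitRotationInvariant + InversionUpgradeNormalised +
IsingEuclidUpgradeR4NonGaussian, items 1979/1980/1982/0636), and equally from any other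
isotropy/inversion/non-Gaussianity line; this route does not attack it. [difficulty: open-problem]
(why it might fail: Rotation invariance on ℤ³ is only postulated (ICM2022 §8.1);
Euclid+scale⇏inversion model-blindly (ScaleCovarianceNotMoebius: a dimension-2 virial current breaks
it); U₄≢0 in d=3 is open and false for RP long-range models on ℤ³ (LongRangeTrivialityOnZ3).)
[DuminilCopinICM2022, PolandRychkovVichi2019, AizenmanDuminilCopinAnnals2021,
Literature.Barriers.CriticalPhenomena.ScaleCovarianceNotMoebius,
Literature.Barriers.CriticalPhenomena.LongRangeTrivialityOnZ3]
#9 UniformRegularity (support) — COMPACTNESS MILESTONE, shared verbatim with route ClusterRigidity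
(item stmt-CriticalPhenomena-4658, ITS crux r3, filed there as an engine-less open problem): with
ρ★(δ) = ⟨σ₀σ_{⌊1/δ⌋e₁}⟩^{-1/2}, for every n and compact K ⊆ NonCoincident 3 n, (a) |F_δ(n,·)| ≤ M_K
for δ < δ₀, (b) uniform asymptotic equicontinuity on K, and (c) F_δ(2,·) ≥ m_K > 0. In THIS route it
is the OUTPUT of the mechanism: CompactnessGlue derives it from TwoPointDoubling + SeparableHoelder
+ NonSeparableModulus ((a),(c) = RescaledBounds). Filed here so that this route's items feed
ClusterRigidity (and the other two existence cards) directly — an alternative decomposition of the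
same decl per D-0019. [difficulty: open-problem] [AizenmanDuminilCopinAnnals2021,
DuminilcopinPanis2025, MessagerMiracleSoleJSP1977, Newman1975Gaussian,
Literature.Probability.LatticeModels.criticalTwoPoint_bounds_holds]
#9 ExistsScaleCovariantLimit (support) — MILESTONE, shared verbatim with route HyperoctahedralRP
(item stmt-CriticalPhenomena-1981, its crux r4 'existence WITHOUT rotations'): ∃ ρ > 0 on (0,1], Δ >
0, S with HasPointwiseScalingLimit (criticalCorr 3) ρ S, S = 0 off NonCoincident,
IsNondegenerateTwoPoint S, IsTranslationInvariant S, IsScaleCovariant Δ S. In THIS route it is the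
output of LimitConstruction (an alternative decomposition of 1981 per D-0019: compactness +
pointwise convergence); filed here so the two routes are joined in the ledger. [difficulty:
open-problem] [DuminilCopinICM2022, AizenmanDuminilCopinAnnals2021]
#9 CriticalCorrNineMirrorRP (support) — LATTICE INPUT, shared verbatim with route HyperoctahedralRP
(item stmt-CriticalPhenomena-1985): nine-mirror reflection positivity of the critical plus-state
correlators on ℤ³ for the site mirrors through the origin (coordinate planes x_i = 0, diagonal
planes x_i = x_j, anti-diagonal planes x_i = −x_j): Σ_ab c_a c_b ⟨σ_{θx^a} σ_{x^b}⟩ ≥ 0 for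
configurations strictly on the positive side. From isingMeasure_univ_free_reflectionPositive on
θ-symmetric boxes + criticalCorr_wellDefined_holds; with plusCorr_shift it gives all integer
offsets, which is what MirrorCauchySchwarz consumes. [difficulty: provable-now]
[FrohlichIsraelLiebSimon1978, FriedliVelenik2017, Biskup2009]
#9 MirrorCauchySchwarz (support) — (L2 of the card) RP–CAUCHY–SCHWARZ TRANSFER on the lattice, for
each of the nine mirror families at every integer offset k (axis planes x_i = k with θ: x_i ↦ 2k −
x_i; diagonal planes x_i − x_j = k with θ: (x_i,x_j) ↦ (x_j + k, x_i − k); anti-diagonal planes x_i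
+ x_j = k with θ: (x_i,x_j) ↦ (k − x_j, k − x_i); ℓ > 0 the strict positive side): for W (m points),
Y (p points), x, x′ strictly on the positive side, (⟨σ_{θx}σ_{θW}σ_Y⟩ − ⟨σ_{θx′}σ_{θW}σ_Y⟩)² ≤
[Q(x,x) − Q(x,x′) − Q(x′,x) + Q(x′,x′)] · ⟨σ_{θY}σ_Y⟩ with Q(u,v) := ⟨σ_{θu}σ_vσ_{θW}σ_W⟩ — B(F,G)²
≤ B(F,F)B(G,G) for the OS form B(F,G) = ⟨θF·G⟩, F = (σ_x − σ_{x′})σ_W, G = σ_Y. Provable now: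
CriticalCorrNineMirrorRP + plusCorr_shift + a 2×2 Gram matrix (template rp_cauchySchwarz_holds).
[difficulty: provable-now] [FrohlichIsraelLiebSimon1978, Biskup2009, FriedliVelenik2017,
Literature.Probability.LatticeModels.rp_cauchySchwarz_holds]
#9 NineMirrorGradient (support) — (L1 of the card) NINE-DIRECTION GRADIENT ESTIMATE for G =
⟨σ₀σ_z⟩⁺_{β_c(3)}: there is C such that for each of the nine lattice vectors u ∈ {e_i, e_i + e_j,
e_i − e_j} and every z with s := u·z ≥ 1: 0 ≤ G(z) − G(z+u) ≤ (C/s)·g(⌊s/8⌋), g(n) = G(n e₁). Sign: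
MMS (messager_miracleSole_holds / _diag_holds; e_i + e_j by coordinate reflection). Upper bound, the
ADC21 §5.5 / DC–Panis device: RP about the planes normal to u (axis: site AND bond planes, both
proved in tree — isingTorus_reflectionPositive_sites/bonds_holds,
isingMeasure_univ_free_reflectionPositive(_of_cross); diagonal: site planes u·x = k, k−1,
consecutive shifts since |u|² = 2) makes W_m = 2G(mu) + G(z₀+mu) + G(z₀−mu) a Stieltjes moment
sequence on [0,1], so W_m − W_{m+1} ≤ (C/m)W_{⌈m/2⌉}; the subtracted pieces are MMS-monotone and MMS
bounds W_{⌈m/2⌉} by 4g(⌊s/8⌋). With (D): |G(z+e) − G(z)| ≤ C′G(z)/‖z‖_∞ for unit steps e in EVERY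
direction (e_j = (s e_i + e_j) − s e_i when |z_j| < ‖z‖_∞/2). [difficulty: M]
[AizenmanDuminilCopinAnnals2021, DuminilCopinPanis2024, MessagerMiracleSoleJSP1977, Hegerfeldt1977,
FrohlichSimonSpencer1976, GlimmJaffe1987]
#9 RescaledBounds (support) — TWO-POINT SPINE ⇒ LOCAL BOUNDS = parts (a) and (c) of
UniformRegularity verbatim, conditional on (D): for every n and compact K ⊆ NonCoincident, |F_n^δ| ≤
M(K) for δ < δ₀ (Gaussian pairing bound aizenman_nPoint_le_pairingSum in infinite volume +
g(r/δ)/g(1/δ) ≤ κ^{-k} for r ≥ 2^{-k} by (D) + MMS angular comparison G(x) ≤ g(‖x‖_∞)); and for n =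
2, F_2^δ ≥ c(K) > 0 (G(x) ≥ g(‖x‖₁) by MMS and g(R/δ)/g(1/δ) ≥ κ^{k} for R ≤ 2^k by (D)). Gives
non-degeneracy of every cluster point and the size factors in SeparableHoelder. [difficulty: M]
[MessagerMiracleSoleJSP1977, Newman1975Gaussian, Aizenman1982,
Literature.Probability.LatticeModels.criticalTwoPoint_bounds_holds]
#9 CompactnessGlue (support) — GLUE 1 (the card's transfer, provable now as an implication):
TwoPointDoubling → SeparableHoelder → NonSeparableModulus → UniformRegularity (conclusion written
out verbatim = item 4658). Parts (a),(c) are RescaledBounds (re-derived from D); part (b): given ε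
and a compact K, thicken to a compact K_η ⊆ NonCoincident, take m from NonSeparableModulus (ε/n on
K_η), then C, δ₀, h₀ from SeparableHoelder with that m, and move the n points one at a time (each
intermediate configuration stays in K_η); separable moves cost C(‖Δx_i‖+δ)^{1/2} < ε/n for r, δ₀
small, non-separable ones < ε/n by NS. [difficulty: M] [GlimmJaffe1987, FrohlichIsraelLiebSimon1978,
Literature.Probability.LatticeModels.isOpen_nonCoincident]
#9 LimitConstruction (support) — GLUE 2 (soft analysis, engine-free, provable now):
UniformRegularity → PointwiseLimit → ExistsScaleCovariantLimit (antecedent = item 4658 verbatim,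
conclusion = item 1981 verbatim). Steps: (i) (b)+PL ⇒ uniformly Cauchy on compacts ⇒
TendstoLocallyUniformlyOn to S n := lim on NonCoincident, S := 0 elsewhere (normalisation); (ii) ρ★
> 0 on (0,1] from criticalTwoPoint_bounds_holds (⌊1/δ⌋ ≥ 1); (iii) IsNondegenerateTwoPoint from (c);
(iv) IsTranslationInvariant from plusCorr_shift + (b) (floor discrepancies are moves of size ≤
√3·δ); (v) IsScaleCovariant: ψ(c) := lim (ρ★(δ)/ρ★(δ/c))² = S₂(cx)/S₂(x) exists, is independent of
x, multiplicative and monotone (MMS in the limit), hence = c^{-2Δ}; Δ ≥ 1/2 > 0 by the PROVED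
scalingDimension_mem_Icc_holds. Cf. ClusterRigidity supports 4660/4661. [difficulty: M]
[Literature.Probability.LatticeModels.scalingDimension_mem_Icc_holds,
Literature.Probability.LatticeModels.criticalTwoPoint_bounds_holds,
Literature.Barriers.CriticalPhenomena.hasPointwiseScalingLimit_of_seq_subseq,
ChelkakHonglerIzyurov2015, DuminilCopinICM2022]

TWO-LAYER PLAN. Foreseen glued splits (none filed now): SeparableHoelder ⇐ LatticeHoelder (the
δ-free lattice inequality: |⟨σ_xσ_Y⟩ − ⟨σ_{x′}σ_Y⟩| ≤
C(|x−x′|/d)^{1/2}·(two-point data), d = distance to the separating mirror) → ContinuumBookkeeping →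
SeparableHoelder; NonSeparableModulus ⇐
ResolvableModulus (configurations resolved by ≤ k mirror doublings, Hölder 2^{-k-1}) → CagedModulus
→ NonSeparableModulus; TwoPointDoubling ⇐
FatScaleDoubling (IR-saturated scales) → LeanScalePropagation (DC–Panis Thm 1.3) → TwoPointDoubling
(the regime split of card
every-scale-regular-multiplicative-fekete).

KILL CRITERIA. ¬TwoPointDoubling (a proof that g(2n_k)/g(n_k) → 0 along some scales at β_c(3))
closes the route (close --reason refuted:TwoPointDoubling):
without doubling ρ₀-renormalised families are not even locally bounded and the compactness approach
to existence is dead for every route.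
A refutation of SeparableHoelder AS TYPED (e.g. the exponent 1/2 or the '+δ' slack is wrong) forces
a restate with a weaker modulus, not a
close — the assembly only needs some modulus. NonSeparableModulus refuted (a caged configuration
with a provable non-uniformity) ⇒ pivot:
restate existence on the separable configuration space only and hand the conjunct-as-typed a
negative note (locally uniform convergence
on all of NonCoincident would then itself be in doubt). PointwiseLimit refuted (an RG limit cycle on
ℤ³) refutes the conjunct itself (single
Δ, full filter). LimitsAreConformal is shared fate with HyperoctahedralRP/IsingEuclidUpgrade: its
refutation in the normalised form kills
clause (ii)/(iii) for everybody. UniformRegularity proved elsewhere (by a mixing argument) moots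
SH/NS for the conjunct but leaves SH/L1/L2 as wanted lattice theorems;
ExistsScaleCovariantLimit proved elsewhere moots D/SH/NS/PL here.

NOT DECOMPOSED YET. The δ-free lattice form of SH and its constants; bond-mirror bookkeeping; the
infinite-volume Gaussian pairing bound (finite-volume version
in tree); the combinatorial 'mirror-resolution' lemma behind the partial mechanism for NS (which
configurations resolve after k doublings —
a finite computation per n, candidate kit job); the Arzelà–Ascoli variant for asymptotically
equicontinuous step functions; regular
variation of ρ₀. All are layer-2 children or prover-side lemmas (--supports), per D-0019.

CHEAPEST FALSIFIER. (a) Numerics already in the literature/kit reach: worm-algorithm data for G at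
β_c(3) on 128³ — check g(2n)/g(n) ∈ [0.45, 0.52] for
4 ≤ n ≤ 32 (2^{-2Δ} ≈ 0.487) AND the diagonal gradient claim of L1: G(2ℓ,m,0)/G(2ℓ,0,0) − 1 = O(m/ℓ)
rather than O(log) — a failure of the
second kills NineMirrorGradient's diagonal step and with it the 'no rotation input' claim. (b) Paper
check a refuter can do in an hour:
derive the Stieltjes property of W_m for u = e₁+e₂ from site-plane RP at offsets k, k−1 (the
planner's derivation is in NOTES.md); if the
odd shifts are NOT positive definite the diagonal estimate needs the even-sublattice transfer matrix
TT* of ADC21 p.18 instead. (c) For NS: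
enumerate, for n ≤ 6 points in general position, whether every (configuration, moving point) is
resolved by ≤ 3 doublings (finite linear
programming over the 18 rays) — calibrates how much of NonCoincident the mirror method really
covers. No kit from this seat (compute-free hub); (b) done by hand (NOTES.md).

NUMBERS. Δ_σ(3D Ising) = 0.5181489(10) (bootstrap), so the doubling constant should be g(2n)/g(n) →
2^{-2Δ} ≈ 0.4875; rigorous window 1/2 ≤ Δ ≤ 1
(scalingDimension_mem_Icc_holds) i.e. c n^{-2} ≤ g(n) ≤ C n^{-1} (criticalTwoPoint_bounds_holds); η
≤ 1/2 if η exists (arXiv:2404.05700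
Thm 1.5). Nine mirror families = the B₃ reflection arrangement (3 coordinate + 6 diagonal planes);
18 rays; a plane through 0 contains ≤ 4 of
the nine normals. Items at open: 14 (5 cruxes; 8 supports of which 3 are shared decls —
UniformRegularity = 4658 of ClusterRigidity, ExistsScaleCovariantLimit = 1981 and
CriticalCorrNineMirrorRP = 1985 of HyperoctahedralRP; 1 assembly).

DEFINITION REQUESTS. None needed to type the items (ρ₀, the nine normals and m-separability are
inlined). Nice-to-have, to shorten signatures later:
`Literature.Probability.LatticeModels.forcedRenormalisation d : ℝ → ℝ` (ρ₀) and `NineMirrorNormal :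
EuclideanSpace ℝ (Fin 3) → Prop`
(shared with route HyperoctahedralRP's inlined disjunction) — not filed from this one-shot seat.

Novelty: Searches (2026-08-15): the card's own audited search (25 sibling cards; lit read arXiv:1912.07973 §5
and arXiv:2404.05700 p.5: axis
direction only; constructive-QFT φ-bounds as nearest relatives); mine: all 25 route files of the sub
as of 11:40Z (grep doubling/equicontinuity/Hoelder/mirror/compact: only ClusterRigidity's
UniformRegularity/Precompactness — compactness WANTED, no mechanism — and
BallOrbitComparison/LogPolarProxy regular-variation cruxes; existence is
monolithic in 1981/0638/1344); `ledger idea list` (112 cards; the three existence cards assume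
precompactness); `lit
search --hybrid "reflection positivity Cauchy-Schwarz regularity Schwinger functions equicontinuity
lattice scaling limit n-point"` (12 book
hits: FriedliVelenik2017 ch.10, GlimmJaffe1987 pp.114/130/337, Montvay–Münster — RP/OS material, no
lattice n-point modulus); `lit read`
GlimmJaffe1987 grep regularity (§7.9, §12.5 regularity of P(φ)₂ fields — continuum, φ-bounds); `lit
search --source crossref "critical
Ising three dimensions scaling limit correlation regularity"` (15: nearest doi:10.1214/13-aop881
Camia–Garban–Newman, planar magnetisation
field, uniqueness via CHI — 2D and field-level); `lit frontier CriticalPhenomena --since 2020` (30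
rows; arXiv:2604.05772 'Percolation in
the 3D Ising model' noted, unrelated mechanism); `lit bridges CriticalPhenomena --cross any`; `lit
galaxy search … --star all` twice —
galaxyd saturated (rc: queued > 90 s), openalex/arxiv/s2 rate-limited (429) at filing, r  [refs: 10.1214/13-aop881, 1912.07973, 2404.05700, 2604.05772, doi:10.1214/13-aop881, FriedliVelenik2017, GlimmJaffe1987, AizenmanDuminilCopinAnnals2021, DuminilCopinPanis2024, FrohlichIsraelLiebSimon1978]

Barriers (technique_class: rp-cauchy-schwarz-regularity, nine-mirror-gradient): - technique_class: rp-cauchy-schwarz-regularity, nine-mirror-gradient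
- Literature.Barriers.CriticalPhenomena.IsingTrivialityFromDimensionFour: not engaged — D, SH, NS,
PL and the lemmas are dimension-uniform COMPACTNESS statements (true or false equally in d ≥ 4,
where the limit is Gaussian); non-Gaussianity sits entirely in the imported LimitsAreConformal,
which keeps the model-specific HasPointwiseScalingLimit (criticalCorr 3) hypothesis.
- Literature.Barriers.CriticalPhenomena.LongRangeTrivialityOnZ3: same — the compactness half is
interaction-blind by design (it would hold for RP long-range models too); the interaction-specific
content is isolated in LimitsAreConformal (U₄) and flagged there.
- Literature.Barriers.CriticalPhenomena.ScaleCovarianceNotMoebius: respected — scale covariance here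
is DERIVED from existence + non-degeneracy (ψ multiplicative and monotone), never upgraded to
inversion; the inversion clause is imported in the normalised, model-specific form the barrier and
Theorems/IsingEuclidUpgradeRefutations.lean leave open.
- Literature.Barriers.CriticalPhenomena.BootstrapLatticeBlindness: evaded — every input is a lattice
fact (nine-plane RP of the n.n. interaction, MMS, GKS, doubling of the lattice two-point function);
no CFT data enter.
- Literature.Barriers.CriticalPhenomena.LiouvilleRigidity: not met — no conformal maps; d = 3
throughout.
- Literature.Barriers.CriticalPhenomena.RigorousRGSmallParameter: not met — no RG map, no small
parameter; scales ent

History (route lifecycle, newest last):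
- 2026-08-26T07:17:40Z · DORMANT — reconciler: no traction for 8.4 d (last activity item-evidence-added at 2026-08-17T21:30:30Z); parked, not closed — `ledger route dormant route-CriticalPhenomen (operator:999:3779338)

sub-problem: Ising3DConformalLimit · status: dormant · opened planner-plancard-CriticalPhenomena-Ising3DCon-2e4b08a3-0 2026-08-15T11:44:50Z · rev 3 · ledger route-CriticalPhenomena-MirrorHoelderCompactness
GENERATED by the gate from the ledger (D-0016/17). Provers cite these decls: `theorem foo : Summit.CriticalPhenomena.Ising3DConformalLimit.Theses.MirrorHoelderCompactness.<Decl> := …` in Summits/CriticalPhenomena/Ising3DConformalLimit/Theorems/<Name>.lean.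
-/

namespace Summit.CriticalPhenomena.Ising3DConformalLimit.Theses.MirrorHoelderCompactness

open scoped BigOperators Topology Manifold Classical MeasureTheory ProbabilityTheory Matrix InnerProductSpace ComplexConjugate ContinuousMap
open Filter Set Function TopologicalSpace MeasureTheory

attribute [summit_statement] _root_.Ising3DConformalLimit

/-- item stmt-CriticalPhenomena-6150 · crux · rank 2 · open · by planner
why it might fail: Uniform doubling is open in print's own words (ADC21 Rem 5.10; after Def 5.11): two-point axiomatics (RP, MMS, IR, DCP lower bound) admit crossover profiles c|x|^(-3/2)+Ce^(-|x|/N)/|x| breaking it by N^(-1/4); Thm 5.12 gives regular scales of positive density only; DCP Thm 1.5: eta's existence open.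
sources: AizenmanDuminilCopinAnnals2021, arXiv:1912.07973, DuminilcopinPanis2025, arXiv:2404.05700, DuminilCopinICM2022, Literature.Probability.LatticeModels.criticalTwoPoint_bounds_holds
[crux] (D) ALL-SCALE DOUBLING of the axial critical two-point function on ℤ³: there is κ > 0 with
g(2n) ≥ κ·g(n) for all n ≥ 1, g(n) := ⟨σ₀σ_{n e₁}⟩⁺_{β_c(3)} (card item M3; = D1 of card
every-scale-regular-multiplicative-fekete). With MMS it gives G(z′) ≍ G(z) for ‖z′‖ ≍ ‖z‖ in all
directions; it is the one open LATTICE input of the compactness half and is filed first (the import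
cone of everything below is otherwise proved: criticalTwoPoint_bounds_holds,
messager_miracleSole_holds, RP lemmas). [difficulty: open-problem] -/
@[route_item "route-CriticalPhenomena-MirrorHoelderCompactness", crux]
def TwoPointDoubling : Prop :=
  ∃ κ : ℝ, 0 < κ ∧ ∀ n : ℕ, 1 ≤ n → κ * Literature.Probability.LatticeModels.criticalTwoPoint 3 (Pi.single 0 (n : ℤ)) ≤ Literature.Probability.LatticeModels.criticalTwoPoint 3 (Pi.single 0 (2 * (n : ℤ)))

/-- item stmt-CriticalPhenomena-6152 · crux · rank 4 · open · by planner
why it might fail: No lattice mechanism at caged points: iterated mirror doubling resolves collinear/planar configurations, but a point caged in all 26 directions of {-1,0,1}^3 is fixed by every doubling; equicontinuity there is as open as continuity of the 3D limit (needs mixing input a la ADC21 sec 6 or a new idea).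
sources: AizenmanDuminilCopinAnnals2021, arXiv:1912.07973, DuminilCopinICM2022, ChelkakHonglerIzyurov2015, GlimmJaffe1987
[crux] (NS) = card item M4, the honestly open complement of (SH): asymptotic equicontinuity under
one-point moves at configurations where the moving point is NOT nine-separable. Form: for every n,
compact K ⊆ NonCoincident and ε > 0 there are m, η, δ₀ > 0 such that for δ < δ₀, x ∈ K, ‖y − x_i‖ <
η and (x, i) not m-separable by any of the nine normals, |F_n^δ(x with x_i ↦ y) − F_n^δ(x)| < ε (the
∃m lets the prover shrink the non-separable zone; SH covers the rest for that m). Partial mechanism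
for provers: iterating MirrorCauchySchwarz ('doubling the configuration across a mirror') halves the
Hölder exponent per step and turns a collinear configuration into a planar trapezoid whose inner
vertex one of the 18 rays exposes; by translation invariance it also suffices that all OTHER points
be separable. This resolves collinear and many planar configurations but NOT a point caged by
neighbours in all 26 directions of {−1,0,1}³ (the cage is invariant under every doubling): there a
different input (random-current regularity à la ADC21 §6, or DLR-inherited regularity) is required.
[deps: SeparableHoelder] [difficulty: open-problem] -/
@[route_item "route-CriticalPhenomena-MirrorHoelderCompactness", crux]
def NonSeparableModulus : Prop :=
  ∀ (n : ℕ) (K : Set (Fin n → EuclideanSpace ℝ (Fin 3))), K ⊆ Literature.Probability.LatticeModels.NonCoincident 3 n → IsCompact K → ∀ ε : ℝ, 0 < ε → ∃ m η δ₀ : ℝ, 0 < m ∧ 0 < η ∧ 0 < δ₀ ∧ ∀ δ ∈ Set.Ioo 0 δ₀, ∀ x ∈ K, ∀ (i : Fin n) (y : EuclideanSpace ℝ (Fin 3)), ‖y - x i‖ < η → ¬ (∃ u : EuclideanSpace ℝ (Fin 3), (∃ i j : Fin 3, i ≠ j ∧ (u = EuclideanSpace.single i 1 ∨ u = EuclideanSpace.single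 i 1 + EuclideanSpace.single j 1 ∨ u = EuclideanSpace.single i 1 - EuclideanSpace.single j 1)) ∧ ((∀ j : Fin n, j ≠ i → inner ℝ u (x j) + m ≤ inner ℝ u (x i)) ∨ (∀ j : Fin n, j ≠ i → inner ℝ u (x i) + m ≤ inner ℝ u (x j)))) → |Literature.Probability.LatticeModels.rescaledCorrelator (Literature.Probability.LatticeModels.criticalCorr 3) (fun δ : ℝ => (Literature.Probability.LatticeModels.criticalTwoPoint 3 (Pi.single 0 ⌊δ⁻¹⌋)) ^ (-(1/2:ℝ))) n δ (Function.update x i y) - Literature.Probability.LatticeModels.rescaledCorrelator (Literature.Probability.LatticeModels.criticalCorr 3) (fun δ : ℝ => (Literature.Probability.LatticeModels.criticalTwoPoint 3 (Pi.single 0 ⌊δ⁻¹⌋)) ^ (-(1/2:ℝ))) n δ x| < ε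

/-- item stmt-CriticalPhenomena-6153 · crux · rank 5 · open · by planner
why it might fail: Open already at n=2: convergence of G([x/d])/g([1/d]) needs regular variation of g in scale and direction (= exponent eta), unknown in d=3 (ICM22 sec 8.4; tree: c|x|^-2 <= G <= C|x|^-1 only); RP/GKS/MMS admit log-periodic discretely scale-invariant profiles; an RG limit cycle refutes it.
sources: DuminilCopinICM2022, AizenmanDuminilCopinAnnals2021, doi:10.1214/13-aop881, ChelkakHonglerIzyurov2015, Literature.Probability.LatticeModels.criticalTwoPoint_bounds_holds
[crux] (PL) POINTWISE CONVERGENCE with the forced renormalisation: for every n and every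
non-coincident x, ρ₀(δ)^n ⟨∏σ_{[x_k/δ]}⟩⁺_{β_c(3)} converges as δ → 0⁺ (to some real number). This
is the uniqueness-of-cluster-points half of existence, deliberately separated from compactness:
given (D)+(SH)+(NS) it is EQUIVALENT to locally uniform convergence (Arzelà–Ascoli), and it is
exactly what the dynamics/rigidity cards (rigidity-supplies-uniqueness, scaling-flow-omega-limit,
zoom-flow-lyapunov-existence) propose to deliver from compactness + identification/Lyapunov inputs;
those become separate routes sharing this decl and the compactness items. [difficulty: open-problem] -/
@[route_item "route-CriticalPhenomena-MirrorHoelderCompactness", crux]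
def PointwiseLimit : Prop :=
  ∀ (n : ℕ), ∀ x ∈ Literature.Probability.LatticeModels.NonCoincident 3 n, ∃ l : ℝ, Filter.Tendsto (fun δ : ℝ => Literature.Probability.LatticeModels.rescaledCorrelator (Literature.Probability.LatticeModels.criticalCorr 3) (fun δ : ℝ => (Literature.Probability.LatticeModels.criticalTwoPoint 3 (Pi.single 0 ⌊δ⁻¹⌋)) ^ (-(1/2:ℝ))) n δ x) (nhdsWithin 0 (Set.Ioi 0)) (nhds l)

/-- item stmt-CriticalPhenomena-6154 · crux · rank 6 · open · by planner
why it might fail: All three conclusions open for the 3D n.n. Ising limit: rotations only postulated (ICM22 sec 8.1); Euclid+scale does not give inversion model-blindly (tree barrier ScaleCovarianceNotMoebius, witnessFamily); U4 nonzero unproved in d=3, false for RP long-range models on Z^3 (LongRangeTrivialityOnZ3).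
sources: DuminilCopinICM2022, PolandRychkovVichi2019, AizenmanDuminilCopinAnnals2021, Literature.Barriers.CriticalPhenomena.ScaleCovarianceNotMoebius, Literature.Barriers.CriticalPhenomena.LongRangeTrivialityOnZ3, doi:10.1103/physreve.93.012144
[crux] (LAC) IMPORTED COMPLEMENT (lowest rank): every pointwise scaling limit S of criticalCorr 3 (ρ
> 0 on (0,1]) that is normalised (S = 0 off NonCoincident — the typing fix of
Theorems/IsingEuclidUpgradeRefutations.lean), non-degenerate, translation invariant and scale
covariant with Δ is O(3)-invariant, inversion covariant with the same Δ, and has U₄ ≢ 0. This is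
route HyperoctahedralRP minus its existence crux (it follows in three lines from that route's
HRP2Rigidity + LimitRotationInvariant + InversionUpgradeNormalised +
IsingEuclidUpgradeR4NonGaussian, items 1979/1980/1982/0636), and equally from any other
isotropy/inversion/non-Gaussianity line; this route does not attack it. [difficulty: open-problem] -/
@[route_item "route-CriticalPhenomena-MirrorHoelderCompactness", crux]
def LimitsAreConformal : Prop :=
  ∀ (ρ : ℝ → ℝ) (Δ : ℝ) (S : Literature.Probability.LatticeModels.CorrFamily 3), (∀ δ ∈ Set.Ioc (0:ℝ) 1, 0 < ρ δ) → Literature.Probability.LatticeModels.HasPointwiseScalingLimit (Literature.Probability.LatticeModels.criticalCorr 3) ρ S → (∀ n z, z ∉ Literature.Probability.LatticeModels.NonCoincident 3 n → S n z = 0) → Literature.Probability.LatticeModels.IsNondegenerateTwoPoint S → Literature.Probability.LatticeModels.IsTranslationInvariant S → Literature.Probability.LatticeModels.IsScaleCovariant Δ S → Literature.Probability.LatticeModels.IsRotationInvariant S ∧ Literature.Probability.LatticeModels.IsInversionCovariant Δ S ∧ Literature.Probability.LatticeModels.HasNontrivialU4 S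

/-- item stmt-CriticalPhenomena-6151 · support · rank 3 · closed · proved by Summit.CriticalPhenomena.Ising3DConformalLimit.MirrorHoelderCompactnessSeparableHoelder.separableHoelder_proof @ eb6ea04d4fb8 (prover) · by planner
why it might fail: Uniform constants need G(z')≍G(z) for comparable ‖z‖ in ALL directions (doubling+MMS) and an infinite-volume pairing bound; the diagonal Stieltjes structure (site planes k, k−1) and the lattice→continuum mirror bookkeeping at margin m are unwritten; exponent 1/2 may degrade to some α>0.
sources: AizenmanDuminilCopinAnnals2021, arXiv:1912.07973, DuminilcopinPanis2025, FrohlichIsraelLiebSimon1978, Newman1975Gaussian, Aizenman1982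
[crux] (SH) THE CARD'S THEOREM (mirror-hoelder-modulus L1+L2 ⇒ Hölder-1/2 modulus), continuum form,
conditional on (D): with ρ★(δ) := ⟨σ₀σ_{⌊1/δ⌋e₁}⟩^{-1/2}, for every n, every compact K of
non-coincident configurations and every margin m > 0 there are C, δ₀, h₀ such that for δ < δ₀, x ∈
K, and a move of ONE point x_i ↦ y with ‖y − x_i‖ ≤ h₀, if some nine-mirror normal u ∈ {e_i, e_i ±
e_j} separates x_i from the other points with margin m (⟨u,x_i⟩ ≥ ⟨u,x_j⟩ + m ∀ j ≠ i, or ≤ … − m),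
then |F_n^δ(x with x_i ↦ y) − F_n^δ(x)| ≤ C (‖y − x_i‖ + δ)^{1/2}, F_n^δ := rescaledCorrelator
(criticalCorr 3) ρ★ n δ. Proof route: MirrorCauchySchwarz across the lattice mirror nearest to the
separating plane bounds the squared difference by a four-term second difference of the TWO-point
function at the reflected scale ≈ 2·dist(x_i,Π)/δ times the 2(n−1)-point function of Y ∪ θY;
NineMirrorGradient + (D) + MMS make the first factor ≤ C(‖y−x_i‖+δ)/m·ρ★^{-2}, the Gaussian pairing
bound + (D) the second ≤ Cρ★^{-2(n−1)}, uniformly in δ. [deps: TwoPointDoubling,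
MirrorCauchySchwarz, NineMirrorGradient, RescaledBounds] [difficulty: L] -/
@[route_item "route-CriticalPhenomena-MirrorHoelderCompactness", crux]
def SeparableHoelder : Prop :=
  TwoPointDoubling → ∀ (n : ℕ) (K : Set (Fin n → EuclideanSpace ℝ (Fin 3))), K ⊆ Literature.Probability.LatticeModels.NonCoincident 3 n → IsCompact K → ∀ m : ℝ, 0 < m → ∃ C δ₀ h₀ : ℝ, 0 < δ₀ ∧ 0 < h₀ ∧ ∀ δ ∈ Set.Ioo 0 δ₀, ∀ x ∈ K, ∀ (i : Fin n) (y : EuclideanSpace ℝ (Fin 3)), ‖y - x i‖ ≤ h₀ → (∃ u : EuclideanSpace ℝ (Fin 3), (∃ i j : Fin 3, i ≠ j ∧ (u = EuclideanSpace.single i 1 ∨ u = EuclideanSpace.single i 1 + EuclideanSpace.single j 1 ∨ u = EuclideanSpace.single i 1 - EuclideanSpace.single j 1)) ∧ ((∀ j : Fin n, j ≠ i → inner ℝ u (x j) + m ≤ inner ℝ u (x i)) ∨ (∀ j : Fin n, j ≠ i → inner ℝ u (x i) + m ≤ inner ℝ u (x j)))) → |Literature.Probability.LatticeModels.rescaledCorrelator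 (Literature.Probability.LatticeModels.criticalCorr 3) (fun δ : ℝ => (Literature.Probability.LatticeModels.criticalTwoPoint 3 (Pi.single 0 ⌊δ⁻¹⌋)) ^ (-(1/2:ℝ))) n δ (Function.update x i y) - Literature.Probability.LatticeModels.rescaledCorrelator (Literature.Probability.LatticeModels.criticalCorr 3) (fun δ : ℝ => (Literature.Probability.LatticeModels.criticalTwoPoint 3 (Pi.single 0 ⌊δ⁻¹⌋)) ^ (-(1/2:ℝ))) n δ x| ≤ C * (‖y - x i‖ + δ) ^ (1 / 2 : ℝ)

-- `SeparableHoelder` holds: proved by `Summit.CriticalPhenomena.Ising3DConformalLimit.MirrorHoelderCompactnessSeparableHoelder.separableHoelder_proof` @ eb6ea04d4fb8 (its module imports this route file, so no `_holds` link can be stated here).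

/-- item stmt-CriticalPhenomena-1985 · support · rank 9 · closed · proved by Summit.CriticalPhenomena.Ising3DConformalLimit.HyperoctahedralRPNineMirror.criticalCorrNineMirrorRP_proof (prover) · by planner
sources: FrohlichIsraelLiebSimon1978, FriedliVelenik2017, Biskup2009
[support, lattice input, FILS 1978] Nine-mirror reflection positivity of the critical plus-state
correlators on ℤ³: for each site mirror through the origin — coordinate plane x_i = 0 (θ negates
x_i, ℓ = x_i), diagonal plane x_i = x_j (θ swaps, ℓ = x_i − x_j), anti-diagonal x_i = −x_j (θ: x_i ↦
−x_j, x_j ↦ −x_i, ℓ = x_i + x_j) — and finitely many lattice configurations x^a strictly inside {ℓ >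
0} with real coefficients c_a: Σ_ab c_a c_b criticalCorr 3 (k_a + k_b) (Fin.append (θ ∘ x^a) x^b) ≥
0, i.e. ⟨ΘF·F⟩⁺_{β_c} ≥ 0. From the proved tree lemma isingMeasure_univ_free_reflectionPositive (any
involutive graph automorphism with every n.n. edge inside P or θP — true for the swap since a bond
changes x_i − x_j by ±1 and never crosses strictly) on symmetric boxes with + boundary field
(θ-symmetric), hasBoxLimit_isingCorr_plus_holds, and closedness of RP under limits; FrohlichEtAl1978
§3 Thm 3.1 (planes through sites), FriedliVelenik2017 Lemma 10.8. -/
@[route_item "route-CriticalPhenomena-MirrorHoelderCompactness"]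
def CriticalCorrNineMirrorRP : Prop :=
  ∀ (θ : Literature.Probability.LatticeModels.Site 3 → Literature.Probability.LatticeModels.Site 3) (ℓ : Literature.Probability.LatticeModels.Site 3 → ℤ), (∃ i j : Fin 3, i ≠ j ∧ ((θ = fun x => Function.update x i (-x i)) ∧ (ℓ = fun x => x i) ∨ (θ = fun x => x ∘ Equiv.swap i j) ∧ (ℓ = fun x => x i - x j) ∨ (θ = fun x => Function.update (Function.update x i (-x j)) j (-x i)) ∧ (ℓ = fun x => x i + x j))) → ∀ (m : ℕ) (k : Fin m → ℕ) (x : (a : Fin m) → Fin (k a) → Literature.Probability.LatticeModels.Site 3) (c : Fin m → ℝ), (∀ a i, 0 < ℓ (x a i)) → 0 ≤ ∑ a, ∑ b, c a * c b * Literature.Probability.LatticeModels.criticalCorr 3 (k a + k b) (Fin.append (fun i => θ (x a i)) (x b))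

/-- `CriticalCorrNineMirrorRP` holds: proved by `Summit.CriticalPhenomena.Ising3DConformalLimit.HyperoctahedralRPNineMirror.criticalCorrNineMirrorRP_proof`. -/
theorem CriticalCorrNineMirrorRP_holds : CriticalCorrNineMirrorRP := _root_.Summit.CriticalPhenomena.Ising3DConformalLimit.HyperoctahedralRPNineMirror.criticalCorrNineMirrorRP_proof

/-- item stmt-CriticalPhenomena-4658 · support · rank 9 · open · by planner
sources: AizenmanDuminilCopinAnnals2021, DuminilcopinPanis2025, MessagerMiracleSoleJSP1977, Newman1975Gaussian, Literature.Probability.LatticeModels.criticalTwoPoint_bounds_holds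
[crux] for every n and compact K ⊆ NonCoincident 3 n: (a) |F_δ(n,x)| ≤ M_K on K for all δ < δ₀(K);
(b) uniform equicontinuity: ∀ε>0 ∃r,δ₀>0 ∀δ<δ₀ ∀x,y∈K, dist x y < r → |F_δ(n,x) − F_δ(n,y)| < ε; (c)
n = 2: F_δ(2,x) ≥ m_K > 0 on K for δ < δ₀. Card item (1) (tightness + non-degeneracy of cluster
points). Engines foreseen: every-scale doubling g(2x) ≍ g(x) and Hölder regularity of rescaled
correlators uniformly in the scale (card every-scale-regular-multiplicative-fekete D1–D3; ADC21
regular scales), Newman's Gaussian inequality |⟨σ_A⟩| ≤ Σ_pairings Π⟨σσ⟩ for (a) at even n ≥ 4,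
m*(β_c)=0 (PROVED: spontaneousMagnetization_criticalBeta_eq_zero_holds) + GHS for odd n,
Messager–Miracle-Solé monotonicity for (c). [difficulty: open-problem] -/
@[route_item "route-CriticalPhenomena-MirrorHoelderCompactness", crux]
def UniformRegularity : Prop :=
  (∀ (n : ℕ) (K : Set (Fin n → EuclideanSpace ℝ (Fin 3))), K ⊆ Literature.Probability.LatticeModels.NonCoincident 3 n → IsCompact K → (∃ M δ₀ : ℝ, 0 < δ₀ ∧ ∀ δ ∈ Set.Ioo 0 δ₀, ∀ x ∈ K, |Literature.Probability.LatticeModels.rescaledCorrelator (Literature.Probability.LatticeModels.criticalCorr 3) (fun δ : ℝ => (Literature.Probability.LatticeModels.criticalTwoPoint 3 (Pi.single 0 ⌊δ⁻¹⌋)) ^ (-(1/2:ℝ))) n δ x| ≤ M) ∧ (∀ ε : ℝ, 0 < ε → ∃ r δ₀ : ℝ, 0 < r ∧ 0 < δ₀ ∧ ∀ δ ∈ Set.Ioo 0 δ₀, ∀ x ∈ K, ∀ y ∈ K, dist x y < r → |Literature.Probability.LatticeModels.rescaledCorrelator (Literature.Probability.LatticeModels.criticalCorr 3) (fun δ : ℝ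 => (Literature.Probability.LatticeModels.criticalTwoPoint 3 (Pi.single 0 ⌊δ⁻¹⌋)) ^ (-(1/2:ℝ))) n δ x - Literature.Probability.LatticeModels.rescaledCorrelator (Literature.Probability.LatticeModels.criticalCorr 3) (fun δ : ℝ => (Literature.Probability.LatticeModels.criticalTwoPoint 3 (Pi.single 0 ⌊δ⁻¹⌋)) ^ (-(1/2:ℝ))) n δ y| < ε)) ∧ (∀ K : Set (Fin 2 → EuclideanSpace ℝ (Fin 3)), K ⊆ Literature.Probability.LatticeModels.NonCoincident 3 2 → IsCompact K → ∃ m δ₀ : ℝ, 0 < m ∧ 0 < δ₀ ∧ ∀ δ ∈ Set.Ioo 0 δ₀, ∀ x ∈ K, m ≤ Literature.Probability.LatticeModels.rescaledCorrelator (Literature.Probability.LatticeModels.criticalCorr 3) (fun δ : ℝ => (Literature.Probability.LatticeModels.criticalTwoPoint 3 (Pi.single 0 ⌊δ⁻¹⌋)) ^ (-(1/2:ℝ))) 2 δ x)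

/-- item stmt-CriticalPhenomena-6155 · support · rank 9 · closed · proved by Summit.CriticalPhenomena.Ising3DConformalLimit.MirrorHoelderCompactnessMirrorCS.mirrorCauchySchwarz_proof @ 045c7b513df3 (prover) · by planner
sources: FrohlichIsraelLiebSimon1978, Biskup2009, FriedliVelenik2017, Literature.Probability.LatticeModels.rp_cauchySchwarz_holds
[support] (L2 of the card) RP–CAUCHY–SCHWARZ TRANSFER on the lattice, for each of the nine mirror
families at every integer offset k (axis planes x_i = k with θ: x_i ↦ 2k − x_i; diagonal planes x_i
− x_j = k with θ: (x_i,x_j) ↦ (x_j + k, x_i − k); anti-diagonal planes x_i + x_j = k with θ: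
(x_i,x_j) ↦ (k − x_j, k − x_i); ℓ > 0 the strict positive side): for W (m points), Y (p points), x,
x′ strictly on the positive side, (⟨σ_{θx}σ_{θW}σ_Y⟩ − ⟨σ_{θx′}σ_{θW}σ_Y⟩)² ≤ [Q(x,x) − Q(x,x′) −
Q(x′,x) + Q(x′,x′)] · ⟨σ_{θY}σ_Y⟩ with Q(u,v) := ⟨σ_{θu}σ_vσ_{θW}σ_W⟩ — B(F,G)² ≤ B(F,F)B(G,G) for
the OS form B(F,G) = ⟨θF·G⟩, F = (σ_x − σ_{x′})σ_W, G = σ_Y. Provable now: CriticalCorrNineMirrorRP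
+ plusCorr_shift + a 2×2 Gram matrix (template rp_cauchySchwarz_holds). [difficulty: provable-now] -/
@[route_item "route-CriticalPhenomena-MirrorHoelderCompactness"]
def MirrorCauchySchwarz : Prop :=
  ∀ (θ : Literature.Probability.LatticeModels.Site 3 → Literature.Probability.LatticeModels.Site 3) (ℓ : Literature.Probability.LatticeModels.Site 3 → ℤ), (∃ (i j : Fin 3) (k : ℤ), i ≠ j ∧ ((θ = fun x => Function.update x i (2 * k - x i)) ∧ (ℓ = fun x => x i - k) ∨ (θ = fun x => Function.update (Function.update x i (x j + k)) j (x i - k)) ∧ (ℓ = fun x => x i - x j - k) ∨ (θ = fun x => Function.update (Function.update x i (k - x j)) j (k - x i)) ∧ (ℓ = fun x => x i + x j - k))) → ∀ (m p : ℕ) (W : Fin m → Literature.Probability.LatticeModels.Site 3) (Y : Fin p → Literature.Probability.LatticeModels.Site 3) (x x' : Literature.Probability.LatticeModels.Site 3), (∀ a, 0 < ℓ (W a)) → (∀ b, 0 < ℓ (Y b)) → 0 < ℓ x → 0 < ℓ x' → (Literature.Probability.LatticeModels.criticalCorr 3 (m + p + 1) (Fin.cons (θ x) (Fin.append (fun a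 => θ (W a)) Y)) - Literature.Probability.LatticeModels.criticalCorr 3 (m + p + 1) (Fin.cons (θ x') (Fin.append (fun a => θ (W a)) Y))) ^ 2 ≤ (Literature.Probability.LatticeModels.criticalCorr 3 (m + m + 1 + 1) (Fin.cons (θ x) (Fin.cons x (Fin.append (fun a => θ (W a)) W))) - Literature.Probability.LatticeModels.criticalCorr 3 (m + m + 1 + 1) (Fin.cons (θ x) (Fin.cons x' (Fin.append (fun a => θ (W a)) W))) - Literature.Probability.LatticeModels.criticalCorr 3 (m + m + 1 + 1) (Fin.cons (θ x') (Fin.cons x (Fin.append (fun a => θ (W a)) W))) + Literature.Probability.LatticeModels.criticalCorr 3 (m + m + 1 + 1) (Fin.cons (θ x') (Fin.cons x' (Fin.append (fun a => θ (W a)) W)))) * Literature.Probability.LatticeModels.criticalCorr 3 (p + p) (Fin.append (fun b => θ (Y b)) Y)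

-- `MirrorCauchySchwarz` holds: proved by `Summit.CriticalPhenomena.Ising3DConformalLimit.MirrorHoelderCompactnessMirrorCS.mirrorCauchySchwarz_proof` @ 045c7b513df3 (its module imports this route file, so no `_holds` link can be stated here).

/-- item stmt-CriticalPhenomena-6156 · support · rank 9 · closed · proved by Summit.CriticalPhenomena.Ising3DConformalLimit.MirrorHoelderNineMirrorGradient.nineMirrorGradient_proof @ 8312c53c83b5 (prover) · by planner
sources: AizenmanDuminilCopinAnnals2021, DuminilCopinPanis2024, MessagerMiracleSoleJSP1977, Hegerfeldt1977, FrohlichSimonSpencer1976, GlimmJaffe1987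
[support] (L1 of the card) NINE-DIRECTION GRADIENT ESTIMATE for G = ⟨σ₀σ_z⟩⁺_{β_c(3)}: there is C
such that for each of the nine lattice vectors u ∈ {e_i, e_i + e_j, e_i − e_j} and every z with s :=
u·z ≥ 1: 0 ≤ G(z) − G(z+u) ≤ (C/s)·g(⌊s/8⌋), g(n) = G(n e₁). Sign: MMS (messager_miracleSole_holds /
_diag_holds; e_i + e_j by coordinate reflection). Upper bound, the ADC21 §5.5 / DC–Panis device: RP
about the planes normal to u (axis: site AND bond planes, both proved in tree —
isingTorus_reflectionPositive_sites/bonds_holds,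
isingMeasure_univ_free_reflectionPositive(_of_cross); diagonal: site planes u·x = k, k−1,
consecutive shifts since |u|² = 2) makes W_m = 2G(mu) + G(z₀+mu) + G(z₀−mu) a Stieltjes moment
sequence on [0,1], so W_m − W_{m+1} ≤ (C/m)W_{⌈m/2⌉}; the subtracted pieces are MMS-monotone and MMS
bounds W_{⌈m/2⌉} by 4g(⌊s/8⌋). With (D): |G(z+e) − G(z)| ≤ C′G(z)/‖z‖_∞ for unit steps e in EVERY
direction (e_j = (s e_i + e_j) − s e_i when |z_j| < ‖z‖_∞/2). [difficulty: M] -/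
@[route_item "route-CriticalPhenomena-MirrorHoelderCompactness"]
def NineMirrorGradient : Prop :=
  ∃ C : ℝ, ∀ (u : Literature.Probability.LatticeModels.Site 3), (∃ i j : Fin 3, i ≠ j ∧ (u = Pi.single i 1 ∨ u = Pi.single i 1 + Pi.single j 1 ∨ u = Pi.single i 1 - Pi.single j 1)) → ∀ z : Literature.Probability.LatticeModels.Site 3, (1 : ℤ) ≤ ∑ i, u i * z i → 0 ≤ Literature.Probability.LatticeModels.criticalTwoPoint 3 z - Literature.Probability.LatticeModels.criticalTwoPoint 3 (z + u) ∧ Literature.Probability.LatticeModels.criticalTwoPoint 3 z - Literature.Probability.LatticeModels.criticalTwoPoint 3 (z + u) ≤ C / ((∑ i, u i * z i : ℤ) : ℝ) * Literature.Probability.LatticeModels.criticalTwoPoint 3 (Pi.single 0 ((∑ i, u i * z i) / 8))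

-- `NineMirrorGradient` holds: proved by `Summit.CriticalPhenomena.Ising3DConformalLimit.MirrorHoelderNineMirrorGradient.nineMirrorGradient_proof` @ 8312c53c83b5 (its module imports this route file, so no `_holds` link can be stated here).

/-- item stmt-CriticalPhenomena-6157 · support · rank 9 · closed · proved by Summit.CriticalPhenomena.Ising3DConformalLimit.MirrorHoelderCompactnessRescaledBounds.rescaledBounds_proof @ 657f3200cf4f (prover) · by planner
sources: MessagerMiracleSoleJSP1977, Newman1975Gaussian, Aizenman1982, Literature.Probability.LatticeModels.criticalTwoPoint_bounds_holds
[support] TWO-POINT SPINE ⇒ LOCAL BOUNDS = parts (a) and (c) of UniformRegularity verbatim,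
conditional on (D): for every n and compact K ⊆ NonCoincident, |F_n^δ| ≤ M(K) for δ < δ₀ (Gaussian
pairing bound aizenman_nPoint_le_pairingSum in infinite volume + g(r/δ)/g(1/δ) ≤ κ^{-k} for r ≥
2^{-k} by (D) + MMS angular comparison G(x) ≤ g(‖x‖_∞)); and for n = 2, F_2^δ ≥ c(K) > 0 (G(x) ≥
g(‖x‖₁) by MMS and g(R/δ)/g(1/δ) ≥ κ^{k} for R ≤ 2^k by (D)). Gives non-degeneracy of every cluster
point and the size factors in SeparableHoelder. [difficulty: M] -/
@[route_item "route-CriticalPhenomena-MirrorHoelderCompactness"]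
def RescaledBounds : Prop :=
  TwoPointDoubling → (∀ (n : ℕ) (K : Set (Fin n → EuclideanSpace ℝ (Fin 3))), K ⊆ Literature.Probability.LatticeModels.NonCoincident 3 n → IsCompact K → ∃ M δ₀ : ℝ, 0 < δ₀ ∧ ∀ δ ∈ Set.Ioo 0 δ₀, ∀ x ∈ K, |Literature.Probability.LatticeModels.rescaledCorrelator (Literature.Probability.LatticeModels.criticalCorr 3) (fun δ : ℝ => (Literature.Probability.LatticeModels.criticalTwoPoint 3 (Pi.single 0 ⌊δ⁻¹⌋)) ^ (-(1/2:ℝ))) n δ x| ≤ M) ∧ (∀ K : Set (Fin 2 → EuclideanSpace ℝ (Fin 3)), K ⊆ Literature.Probability.LatticeModels.NonCoincident 3 2 → IsCompact K → ∃ m δ₀ : ℝ, 0 < m ∧ 0 < δ₀ ∧ ∀ δ ∈ Set.Ioo 0 δ₀, ∀ x ∈ K, m ≤ Literature.Probability.LatticeModels.rescaledCorrelator (Literature.Probability.LatticeModels.criticalCorr 3) (fun δ : ℝ => (Literature.Probability.LatticeModels.criticalTwoPoint 3 (Pi.single 0 ⌊δ⁻¹⌋)) ^ (-(1/2:ℝ)))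 2 δ x)

-- `RescaledBounds` holds: proved by `Summit.CriticalPhenomena.Ising3DConformalLimit.MirrorHoelderCompactnessRescaledBounds.rescaledBounds_proof` @ 657f3200cf4f (its module imports this route file, so no `_holds` link can be stated here).

/-- item stmt-CriticalPhenomena-6158 · support · rank 9 · closed · proved by Summit.CriticalPhenomena.Ising3DConformalLimit.MirrorHoelderCompactnessGlue.compactnessGlue_proof @ 58672f046ac3 (prover) · by planner
sources: GlimmJaffe1987, FrohlichIsraelLiebSimon1978, Literature.Probability.LatticeModels.isOpen_nonCoincident
[support] GLUE 1 (the card's transfer, provable now as an implication): TwoPointDoubling →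
SeparableHoelder → NonSeparableModulus → UniformRegularity (conclusion written out verbatim = item
4658). Parts (a),(c) are RescaledBounds (re-derived from D); part (b): given ε and a compact K,
thicken to a compact K_η ⊆ NonCoincident, take m from NonSeparableModulus (ε/n on K_η), then C, δ₀,
h₀ from SeparableHoelder with that m, and move the n points one at a time (each intermediate
configuration stays in K_η); separable moves cost C(‖Δx_i‖+δ)^{1/2} < ε/n for r, δ₀ small,
non-separable ones < ε/n by NS. [difficulty: M] -/
@[route_item "route-CriticalPhenomena-MirrorHoelderCompactness", crux]
def CompactnessGlue : Prop :=
  TwoPointDoubling → SeparableHoelder → NonSeparableModulus → (∀ (n : ℕ) (K : Set (Fin n → EuclideanSpace ℝ (Fin 3))), K ⊆ Literature.Probability.LatticeModels.NonCoincident 3 n → IsCompact K → (∃ M δ₀ : ℝ, 0 < δ₀ ∧ ∀ δ ∈ Set.Ioo 0 δ₀, ∀ x ∈ K, |Literature.Probability.LatticeModels.rescaledCorrelator (Literature.Probability.LatticeModels.criticalCorr 3) (fun δ : ℝ => (Literature.Probability.LatticeModels.criticalTwoPoint 3 (Pi.single 0 ⌊δ⁻¹⌋)) ^ (-(1/2:ℝ)))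 n δ x| ≤ M) ∧ (∀ ε : ℝ, 0 < ε → ∃ r δ₀ : ℝ, 0 < r ∧ 0 < δ₀ ∧ ∀ δ ∈ Set.Ioo 0 δ₀, ∀ x ∈ K, ∀ y ∈ K, dist x y < r → |Literature.Probability.LatticeModels.rescaledCorrelator (Literature.Probability.LatticeModels.criticalCorr 3) (fun δ : ℝ => (Literature.Probability.LatticeModels.criticalTwoPoint 3 (Pi.single 0 ⌊δ⁻¹⌋)) ^ (-(1/2:ℝ))) n δ x - Literature.Probability.LatticeModels.rescaledCorrelator (Literature.Probability.LatticeModels.criticalCorr 3) (fun δ : ℝ => (Literature.Probability.LatticeModels.criticalTwoPoint 3 (Pi.single 0 ⌊δ⁻¹⌋)) ^ (-(1/2:ℝ))) n δ y| < ε)) ∧ (∀ K : Set (Fin 2 → EuclideanSpace ℝ (Fin 3)), K ⊆ Literature.Probability.LatticeModels.NonCoincident 3 2 → IsCompact K → ∃ m δ₀ : ℝ, 0 < m ∧ 0 < δ₀ ∧ ∀ δ ∈ Set.Ioo 0 δ₀, ∀ x ∈ K, m ≤ Literature.Probability.LatticeModels.rescaledCorrelator (Literature.Probability.LatticeModels.criticalCorr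 3) (fun δ : ℝ => (Literature.Probability.LatticeModels.criticalTwoPoint 3 (Pi.single 0 ⌊δ⁻¹⌋)) ^ (-(1/2:ℝ))) 2 δ x)

-- `CompactnessGlue` holds: proved by `Summit.CriticalPhenomena.Ising3DConformalLimit.MirrorHoelderCompactnessGlue.compactnessGlue_proof` @ 58672f046ac3 (its module imports this route file, so no `_holds` link can be stated here).

/-- item stmt-CriticalPhenomena-6159 · support · rank 9 · closed · proved by Summit.CriticalPhenomena.Ising3DConformalLimit.MirrorHoelderLimitConstruction.limitConstruction_proof @ 02883de4a53b (prover) · by planner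
sources: Literature.Probability.LatticeModels.scalingDimension_mem_Icc_holds, Literature.Probability.LatticeModels.criticalTwoPoint_bounds_holds, Literature.Barriers.CriticalPhenomena.hasPointwiseScalingLimit_of_seq_subseq, ChelkakHonglerIzyurov2015, DuminilCopinICM2022
[support] GLUE 2 (soft analysis, engine-free, provable now): UniformRegularity → PointwiseLimit →
ExistsScaleCovariantLimit (antecedent = item 4658 verbatim, conclusion = item 1981 verbatim). Steps:
(i) (b)+PL ⇒ uniformly Cauchy on compacts ⇒ TendstoLocallyUniformlyOn to S n := lim on
NonCoincident, S := 0 elsewhere (normalisation); (ii) ρ★ > 0 on (0,1] from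
criticalTwoPoint_bounds_holds (⌊1/δ⌋ ≥ 1); (iii) IsNondegenerateTwoPoint from (c); (iv)
IsTranslationInvariant from plusCorr_shift + (b) (floor discrepancies are moves of size ≤ √3·δ); (v)
IsScaleCovariant: ψ(c) := lim (ρ★(δ)/ρ★(δ/c))² = S₂(cx)/S₂(x) exists, is independent of x,
multiplicative and monotone (MMS in the limit), hence = c^{-2Δ}; Δ ≥ 1/2 > 0 by the PROVED
scalingDimension_mem_Icc_holds. Cf. ClusterRigidity supports 4660/4661. [difficulty: M] -/
@[route_item "route-CriticalPhenomena-MirrorHoelderCompactness", crux]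
def LimitConstruction : Prop :=
  ((∀ (n : ℕ) (K : Set (Fin n → EuclideanSpace ℝ (Fin 3))), K ⊆ Literature.Probability.LatticeModels.NonCoincident 3 n → IsCompact K → (∃ M δ₀ : ℝ, 0 < δ₀ ∧ ∀ δ ∈ Set.Ioo 0 δ₀, ∀ x ∈ K, |Literature.Probability.LatticeModels.rescaledCorrelator (Literature.Probability.LatticeModels.criticalCorr 3) (fun δ : ℝ => (Literature.Probability.LatticeModels.criticalTwoPoint 3 (Pi.single 0 ⌊δ⁻¹⌋)) ^ (-(1/2:ℝ))) n δ x| ≤ M) ∧ (∀ ε : ℝ, 0 < ε → ∃ r δ₀ : ℝ, 0 < r ∧ 0 < δ₀ ∧ ∀ δ ∈ Set.Ioo 0 δ₀, ∀ x ∈ K, ∀ y ∈ K, dist x y < r → |Literature.Probability.LatticeModels.rescaledCorrelator (Literature.Probability.LatticeModels.criticalCorr 3) (fun δ : ℝ => (Literature.Probability.LatticeModels.criticalTwoPoint 3 (Pi.single 0 ⌊δ⁻¹⌋)) ^ (-(1/2:ℝ))) n δ x - Literature.Probability.LatticeModels.rescaledCorrelator (Literature.Probability.LatticeModels.criticalCorr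 3) (fun δ : ℝ => (Literature.Probability.LatticeModels.criticalTwoPoint 3 (Pi.single 0 ⌊δ⁻¹⌋)) ^ (-(1/2:ℝ))) n δ y| < ε)) ∧ (∀ K : Set (Fin 2 → EuclideanSpace ℝ (Fin 3)), K ⊆ Literature.Probability.LatticeModels.NonCoincident 3 2 → IsCompact K → ∃ m δ₀ : ℝ, 0 < m ∧ 0 < δ₀ ∧ ∀ δ ∈ Set.Ioo 0 δ₀, ∀ x ∈ K, m ≤ Literature.Probability.LatticeModels.rescaledCorrelator (Literature.Probability.LatticeModels.criticalCorr 3) (fun δ : ℝ => (Literature.Probability.LatticeModels.criticalTwoPoint 3 (Pi.single 0 ⌊δ⁻¹⌋)) ^ (-(1/2:ℝ))) 2 δ x)) → PointwiseLimit → ∃ (ρ : ℝ → ℝ) (Δ : ℝ) (S : Literature.Probability.LatticeModels.CorrFamily 3), (∀ δ ∈ Set.Ioc (0:ℝ) 1, 0 < ρ δ) ∧ 0 < Δ ∧ Literature.Probability.LatticeModels.HasPointwiseScalingLimit (Literature.Probability.LatticeModels.criticalCorr 3) ρ S ∧ (∀ n z, z ∉ Literature.Probability.LatticeModels.NonCoincident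 3 n → S n z = 0) ∧ Literature.Probability.LatticeModels.IsNondegenerateTwoPoint S ∧ Literature.Probability.LatticeModels.IsTranslationInvariant S ∧ Literature.Probability.LatticeModels.IsScaleCovariant Δ S

-- `LimitConstruction` holds: proved by `Summit.CriticalPhenomena.Ising3DConformalLimit.MirrorHoelderLimitConstruction.limitConstruction_proof` @ 02883de4a53b (its module imports this route file, so no `_holds` link can be stated here).

/-- item stmt-CriticalPhenomena-6160 · assembly · rank 1 · closed · proved by Summit.CriticalPhenomena.Ising3DConformalLimit.Theorems.mirrorHoelderCompactness_assembly_proof @ 0729add9284b (prover) · by planner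
sources: DuminilCopinICM2022, ChelkakHonglerIzyurov2015
[assembly] TwoPointDoubling → SeparableHoelder → NonSeparableModulus → PointwiseLimit →
CompactnessGlue → LimitConstruction → LimitsAreConformal → Ising3DConformalLimit. -/
@[route_item "route-CriticalPhenomena-MirrorHoelderCompactness"]
def Assembly : Prop :=
  TwoPointDoubling → SeparableHoelder → NonSeparableModulus → PointwiseLimit → CompactnessGlue → LimitConstruction → LimitsAreConformal → Ising3DConformalLimit

-- `Assembly` holds: proved by `Summit.CriticalPhenomena.Ising3DConformalLimit.Theorems.mirrorHoelderCompactness_assembly_proof` @ 0729add9284b (its module imports this route file, so no `_holds` link can be stated here).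

/-! D-0027 §2.1 — DECIDING THEOREM (planner-authored via `route open/edit --closes-file`; by planner-rrepair-CriticalPhenomena-MirrorHoelde-fc4be20a-g2-0 2026-08-15T16:55:03Z):
its hypotheses are this route's items and its conclusion the sub-problem Statement (glue_lint), and it elaborates with this file. -/

@[closes "route-CriticalPhenomena-MirrorHoelderCompactness"] theorem closes : TwoPointDoubling → SeparableHoelder → NonSeparableModulus → PointwiseLimit → CompactnessGlue → LimitConstruction → LimitsAreConformal → _root_.Ising3DConformalLimit :=
  fun hD hSH hNS hPL hCG hLC hLAC =>
    match hLC (hCG hD hSH hNS) hPL with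
    | ⟨ρ, Δ, S, hρ, hΔ, hlim, hnorm, hnd, htr, hsc⟩ =>
      match hLAC ρ Δ S hρ hlim hnorm hnd htr hsc with
      | ⟨hrot, hinv, hU4⟩ => ⟨ρ, Δ, S, hρ, hΔ, hlim, hnd, ⟨⟨htr, hrot⟩, hsc, hinv⟩, hU4⟩

end Summit.CriticalPhenomena.Ising3DConformalLimit.Theses.MirrorHoelderCompactness
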